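import Summits.RiemannHypothesis.RiemannHypothesis.Theorems.SoloInformedGroundStatePoisson
import Mathlib.Analysis.Calculus.SmoothSeries
import Mathlib.Analysis.Calculus.IteratedDeriv.Defs
import Mathlib.Analysis.Distribution.SchwartzSpace.Deriv
import Mathlib.Analysis.Distribution.TemperateGrowth

/-!
# Handoff (rh-explicit, prove-1), Route E: the E-map sum is differentiable on `(0, ∞)` and
`E_h′(u) = u⁻¹ · E_{x·h′}(u)` (the one-integration-by-parts identity of handoff/prove-1 ATTEMPT-14, LEMMA Z)

For a Schwartz seed `h` and a dilation `λ > 0` the E-map image is the dilated sum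
`eMapFn h λ u = ∑_{n ≥ 1} h(n u/λ)` (`u > 0`; tree file `SoloInformedGroundStatePoisson.lean`). We prove
that it is differentiable at every `u > 0` with derivative the termwise one,
`∑_{n ≥ 1} (n/λ) · h′(n u/λ)` (locally uniform convergence from the Schwartz bound `‖h′(x)‖ ≤ C/x³`),
and hence the identity used for the strip decay of the zero side in ATTEMPT-14 §1–2 (LEMMA Z: one
integration by parts in `u`): `E_h′(u) = u⁻¹ · E_g(u)` for every Schwartz `g` with `g(x) = x·h′(x)` — the
derivative of an E-map image is again an E-map image, divided by `u`. Nothing here bears on RH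
(real-variable calculus of a dilated sum). [elementary; Mathlib `hasDerivAt_tsum_of_isPreconnected`]
-/

set_option linter.dupNamespace false

noncomputable section

open Set Filter Topology

namespace Summit.RiemannHypothesis.RiemannHypothesis.Theorems.HandoffEMapDeriv

open Summit.RiemannHypothesis.RiemannHypothesis.Theorems (eMapFn eMapFn_of_pos norm_schwartz_le_div_sq)

/-- Schwartz decay of the derivative in the form used below: `‖h′ x‖ ≤ C / x³` for `x > 0`, `C` the
`(3,1)` seminorm. [elementary] -/
theorem norm_deriv_schwartz_le_div_cube (h : SchwartzMap ℝ ℂ) {x : ℝ} (hx : 0 < x) :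
    ‖deriv h x‖ ≤ SchwartzMap.seminorm ℝ 3 1 h / x ^ 3 := by
  have key := SchwartzMap.le_seminorm ℝ 3 1 h x
  rw [norm_iteratedFDeriv_eq_norm_iteratedDeriv, iteratedDeriv_one, Real.norm_eq_abs,
    abs_of_pos hx] at key
  rw [le_div_iff₀ (by positivity)]
  linarith [mul_comm (x ^ 3) ‖deriv (⇑h) x‖]

/-- Each dilated term is differentiable: `d/dy h(c·y/λ) = (c/λ)·h′(c·y/λ)`. [elementary] -/
theorem hasDerivAt_dilate (h : SchwartzMap ℝ ℂ) (c lam y : ℝ) :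
    HasDerivAt (fun y : ℝ => h (c * (lam⁻¹ * y)))
      (((c * lam⁻¹ : ℝ) : ℂ) * deriv h (c * (lam⁻¹ * y))) y := by
  have h1 : HasDerivAt (fun y : ℝ => c * (lam⁻¹ * y)) (c * lam⁻¹) y := by
    have := ((hasDerivAt_id y).const_mul lam⁻¹).const_mul c
    simpa [mul_assoc] using this
  have h2 : HasDerivAt (⇑h) (deriv h (c * (lam⁻¹ * y))) (c * (lam⁻¹ * y)) :=
    h.differentiableAt.hasDerivAt
  have h3 := h2.scomp y h1
  simpa [Function.comp_def, Complex.real_smul] using h3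

/-- TERMWISE DIFFERENTIATION of the dilated sum on `(0, ∞)`:
`d/du ∑_{n ≥ 1} h(n u/λ) = ∑_{n ≥ 1} (n/λ)·h′(n u/λ)` at every `u > 0`. [elementary] -/
theorem hasDerivAt_dilatedSum (h : SchwartzMap ℝ ℂ) {lam : ℝ} (hlam : 0 < lam) {u : ℝ} (hu : 0 < u) :
    HasDerivAt (fun y : ℝ => ∑' n : ℕ, h (((n + 1 : ℕ) : ℝ) * (lam⁻¹ * y)))
      (∑' n : ℕ, ((((n + 1 : ℕ) : ℝ) * lam⁻¹ : ℝ) : ℂ) * deriv h (((n + 1 : ℕ) : ℝ) * (lam⁻¹ * u))) u := by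
  set a := u / 2 with ha_def
  have ha : 0 < a := half_pos hu
  have hau : a < u := half_lt_self hu
  set C := SchwartzMap.seminorm ℝ 3 1 h with hC
  have hC0 : 0 ≤ C := by positivity
  have hsum2 : Summable fun n : ℕ => 1 / ((n + 1 : ℕ) : ℝ) ^ 2 :=
    (summable_nat_add_iff (f := fun n : ℕ => 1 / (n : ℝ) ^ 2) 1).mpr
      (Real.summable_one_div_nat_pow.mpr one_lt_two)
  refine hasDerivAt_tsum_of_isPreconnected
    (u := fun n : ℕ => C * (lam ^ 2 / a ^ 3) * (1 / ((n + 1 : ℕ) : ℝ) ^ 2))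
    (g := fun (n : ℕ) (y : ℝ) => h (((n + 1 : ℕ) : ℝ) * (lam⁻¹ * y)))
    (g' := fun (n : ℕ) (y : ℝ) =>
      ((((n + 1 : ℕ) : ℝ) * lam⁻¹ : ℝ) : ℂ) * deriv h (((n + 1 : ℕ) : ℝ) * (lam⁻¹ * y)))
    (t := Ioi a) (y₀ := u) (hsum2.mul_left _) isOpen_Ioi isPreconnected_Ioi
    (fun n y _ => hasDerivAt_dilate h _ lam y) ?_ hau ?_ hau
  · -- the summable bound on the termwise derivatives on `(a, ∞)`
    intro n y hy
    have hy0 : a < y := hy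
    have hx0 : 0 < ((n + 1 : ℕ) : ℝ) * (a / lam) := by positivity
    have hx : ((n + 1 : ℕ) : ℝ) * (a / lam) ≤ ((n + 1 : ℕ) : ℝ) * (lam⁻¹ * y) := by
      apply mul_le_mul_of_nonneg_left _ (by positivity)
      rw [inv_mul_eq_div]
      exact div_le_div_of_nonneg_right hy0.le hlam.le
    have hxpos : 0 < ((n + 1 : ℕ) : ℝ) * (lam⁻¹ * y) := hx0.trans_le hx
    have hcoef : ‖((((n + 1 : ℕ) : ℝ) * lam⁻¹ : ℝ) : ℂ)‖ = ((n + 1 : ℕ) : ℝ) * lam⁻¹ := by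
      rw [Complex.norm_real, Real.norm_eq_abs, abs_of_pos (by positivity)]
    rw [norm_mul, hcoef]
    calc ((n + 1 : ℕ) : ℝ) * lam⁻¹ * ‖deriv (⇑h) (((n + 1 : ℕ) : ℝ) * (lam⁻¹ * y))‖
        ≤ ((n + 1 : ℕ) : ℝ) * lam⁻¹ * (C / (((n + 1 : ℕ) : ℝ) * (lam⁻¹ * y)) ^ 3) :=
          mul_le_mul_of_nonneg_left (norm_deriv_schwartz_le_div_cube h hxpos) (by positivity)
      _ ≤ ((n + 1 : ℕ) : ℝ) * lam⁻¹ * (C / (((n + 1 : ℕ) : ℝ) * (a / lam)) ^ 3) := by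
          apply mul_le_mul_of_nonneg_left _ (by positivity)
          apply div_le_div_of_nonneg_left hC0 (by positivity)
          exact pow_le_pow_left₀ hx0.le hx 3
      _ = C * (lam ^ 2 / a ^ 3) * (1 / ((n + 1 : ℕ) : ℝ) ^ 2) := by
          field_simp
  · -- convergence at one point (`y₀ = u`), from `‖h x‖ ≤ C₂/x²`
    refine Summable.of_norm_bounded
      ((hsum2.mul_left (SchwartzMap.seminorm ℝ 2 0 h * (lam / u) ^ 2))) fun n => ?_
    have hxpos : 0 < ((n + 1 : ℕ) : ℝ) * (lam⁻¹ * u) := by positivity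
    calc ‖h (((n + 1 : ℕ) : ℝ) * (lam⁻¹ * u))‖
        ≤ SchwartzMap.seminorm ℝ 2 0 h / (((n + 1 : ℕ) : ℝ) * (lam⁻¹ * u)) ^ 2 :=
          norm_schwartz_le_div_sq h hxpos
      _ = SchwartzMap.seminorm ℝ 2 0 h * (lam / u) ^ 2 * (1 / ((n + 1 : ℕ) : ℝ) ^ 2) := by
          field_simp

/-- The E-map image `eMapFn h λ` is differentiable at every `u > 0`, with the termwise derivative.
[elementary] -/
theorem hasDerivAt_eMapFn (h : SchwartzMap ℝ ℂ) {lam : ℝ} (hlam : 0 < lam) {u : ℝ} (hu : 0 < u) :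
    HasDerivAt (eMapFn h lam)
      (∑' n : ℕ, ((((n + 1 : ℕ) : ℝ) * lam⁻¹ : ℝ) : ℂ) * deriv h (((n + 1 : ℕ) : ℝ) * (lam⁻¹ * u))) u := by
  refine (hasDerivAt_dilatedSum h hlam hu).congr_of_eventuallyEq ?_
  filter_upwards [Ioi_mem_nhds hu] with y hy
  exact eMapFn_of_pos h lam hy

/-- THE ONE-IBP IDENTITY `E_h′(u) = u⁻¹ · E_g(u)` (`u > 0`) for every Schwartz `g` with
`g(x) = x · h′(x)`: the derivative of the E-map image of `h` is `u⁻¹` times the E-map image of `x·h′`.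
(This is what makes one integration by parts in `u` free of boundary terms at the cutoff and turns the
strip decay of the zero side into the leak of ANOTHER seed — ATTEMPT-14 LEMMA Z.) [elementary] -/
theorem hasDerivAt_eMapFn_eq_inv_mul_eMapFn (h g : SchwartzMap ℝ ℂ)
    (hg : ∀ x : ℝ, g x = (x : ℂ) * deriv h x) {lam : ℝ} (hlam : 0 < lam) {u : ℝ} (hu : 0 < u) :
    HasDerivAt (eMapFn h lam) (((u⁻¹ : ℝ) : ℂ) * eMapFn g lam u) u := by
  have key := hasDerivAt_eMapFn h hlam hu
  have hu0 : (u : ℂ) ≠ 0 := by exact_mod_cast hu.ne'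
  convert key using 1
  rw [eMapFn_of_pos g lam hu, ← tsum_mul_left]
  refine tsum_congr fun n => ?_
  rw [hg]
  push_cast
  field_simp

/-- The same identity with the Schwartz function `x ↦ x·h′(x)` realised in Mathlib as
`smulLeftCLM ℂ (↑) (derivCLM ℝ ℂ h)` (multiplication by the temperate-growth function `x ↦ (x : ℂ)`
after the derivative CLM): `E_h′(u) = u⁻¹ · E_{x·h′}(u)` for `u > 0`, unconditionally. [elementary] -/
theorem hasDerivAt_eMapFn_eq_inv_mul_eMapFn_xDeriv (h : SchwartzMap ℝ ℂ) {lam : ℝ} (hlam : 0 < lam)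
    {u : ℝ} (hu : 0 < u) :
    HasDerivAt (eMapFn h lam)
      (((u⁻¹ : ℝ) : ℂ) *
        eMapFn (SchwartzMap.smulLeftCLM ℂ (Complex.ofReal) (SchwartzMap.derivCLM ℝ ℂ h)) lam u) u :=
  hasDerivAt_eMapFn_eq_inv_mul_eMapFn h _
    (fun x => by
      rw [SchwartzMap.smulLeftCLM_apply_apply Function.Complex.hasTemperateGrowth_ofReal,
        SchwartzMap.derivCLM_apply, smul_eq_mul])
    hlam hu

end Summit.RiemannHypothesis.RiemannHypothesis.Theorems.HandoffEMapDeriv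

end
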